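import Summits.AtomisticToContinuum.FouriersLaw.Theses.EmbeddedDrudeMourre
import Literature.MathematicalPhysics.KineticTheory.ZeroWavenumberSpace
import Literature.MathematicalPhysics.KineticTheory.FluctuationUnitaryGroup
import Literature.MathematicalPhysics.KineticTheory.InfiniteChainSuperstableDynamics
import Literature.Analysis.UnboundedOperators.HilbertComplexification
import Literature.Analysis.UnboundedOperators.ConjugateOperatorRegularity
import Summits.AtomisticToContinuum.FouriersLaw.Theorems.EmbeddedDrudeMourreMourreDissolutionLineReduction
import Summits.AtomisticToContinuum.FouriersLaw.Theorems.EmbeddedDrudeMourreMourreDissolutionStubOddStratumFloor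
import Summits.AtomisticToContinuum.FouriersLaw.Theorems.EmbeddedDrudeMourreDrudeDissolutionStubRichFramework

/-!
# Line `parity-count-second-quantised-fgr` — checked skeleton v3 for the crux `EmbeddedDrudeMourre.MourreDissolution`
(stmt-AtomisticToContinuum-12594, rank-2 crux of route `route-AtomisticToContinuum-EmbeddedDrudeMourre`,
sub-problem `AtomisticToContinuum/FouriersLaw`; planner skeleton v1 2026-08-16, crux-plan round 1;
RESHAPED by lead c12 `prover-line-stmt-AtomisticToContinuum-12594-c12-0`, 2026-08-17)

Crux (FIXED — the route decl, never restated): for `pinnedChain ω₂ lam β γ` (all four `> 0`), IF ALS's linearised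
phonon Boltzmann form has an odd-sector gap (`PhononBoltzmann.HasOddSectorGap ω₂ lam β`) THEN there is `T₀ > 0` such
that for every `T ∈ (0, T₀)` some Gibbs state `μ_T` with a `μ_T`-preserving infinite-volume dynamics `D` (absolutely
convergent current correlations) has `C_T(t) = Σ_x ∫ j_0 (j_x ∘ φ_t) dμ_T = ∫ cos(ωt) dσ(ω)` for a finite measure `σ`
carrying, on a window `(-δ, δ)`, a continuous density `g ≥ 0` with `g 0 > 0`.

## The line in one paragraph (card `Ideas/parity-count-second-quantised-fgr.md`, line card `Lines/parity-count-second-quantised-fgr.md`)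

The Fermi-golden-rule (level-shift) operator of the `m`-th co-moving stratum of the free zero-wavenumber tower is the
`m`-body linearised collision form `Σᵢ q⁽ⁱ⁾`; a momentum-inversion-odd `m`-point profile splits `L²`-orthogonally
into parity patterns each carrying an ODD number of odd legs, so `HasOddSectorGap` alone gives the floor
`Σᵢ q⁽ⁱ⁾(F) ≥ g‖F‖²` UNIFORMLY in `m` — Stub A. Dressing the conjugate operator on every stratum makes the threshold at
frequency `0` dissipative: a STRICT Mourre estimate at `0`, with Mourre's `C²` regularity, for the Liouvillean restricted
to a closed `U_t`-invariant subspace `K ∋ [J]_ℂ` of the complexified Doyon space (inside the spatial-reflection-odd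
sector) of the RICH symmetric zero-wavenumber datum (Stub B′: coordinates and products in `𝒱`, so every stratum vector
has a class) — Stub C′, THE BET, fed by A. Mourre's limiting absorption principle (the tree's PROVED
`MourreDissolution.stub_mourreThresholdLAP`, Mourre's `C²` form, 18 LAP files), cosine Bochner (`stub_cosineBochner`) and
Poisson window inversion (`stub_poissonWindowInversion`) turn C′ into the window density; positivity `g(0) > 0` is the
Fermi-golden-rule floor of the Abel means — Stub E′ (= S7 of line separable-vertex, reduced in the tree to route
KineticCorner's Green–Kubo statement stmt-3429 by `stub_fgrPositivity_of_kineticGreenKubo`, p121549).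

## v2 reshape (lead c12) — what changed against the planner's v1 and why

* A `stub_oddStratumFloor` — UNCHANGED (provable now: corollary of the landed `MourreDissolution.stub_oddTowerFloor
  stub_oddParityFloor`, p128479/p128131, which differ only in hypothesis order and the spelling of periodicity).
* B → B′ `stub_framework` — the rich symmetric framework the tree PROVES over the canonical Buttà–Marchioro dynamics
  (`KineticPolymerGasOnTheTimeAxis.stub_richFramework`, p138890) with the two clauses C′/E′ consume made explicit:
  `HasSuperstabilityEstimate Z.μ` and `ι ∘ φ_t = φ_t ∘ ι` everywhere (both available inside that proof:
  `richFramework_clustering`, `pencilFramework_dynamics`).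
* C → C′ `stub_dressedStratumMourre` — the planner's `𝒞^{1,1}(𝒜)` + Besov-`(D(𝒜),K)_{1/2,1}` package is replaced by
  Mourre's `C²` package (`C¹(𝒜)`, strict estimate `HasMourreEstimateOn 𝒜 (−δ,δ) a`, localised commutators `C¹(𝒜)`,
  `[J]_ℂ ∈ D(𝒜)`), i.e. exactly the hypotheses of the LANDED LAP theorem; hypotheses = B′'s outputs; `K` stays a
  closed `U_t`-invariant complex subspace containing `[J]_ℂ` (weaker than separable-vertex's S5, which fixes `K` = the
  whole ι-odd sector). Reason: the v1 engine D (`stub_mourreWindowDensity`: gap-free `𝒞^{1,1}` LAP for an UNBOUNDED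
  generator in the optimal Besov class, ABG Thm 7.4.1/7.5.4 + Sahbani 1997) is XL and not in reach (lead c1's S6
  analysis: ABG's `𝒞^{1,1}` LAP needs a gap or the Friedrichs scale), while Mourre's `C²` LAP is in the tree.
* D `stub_mourreWindowDensity` — DROPPED as a stub: discharged inside the composition by the tree theorems
  `stub_mourreThresholdLAP` + `stub_cosineBochner` + `stub_poissonWindowInversion` (route support `AbelOfSpectralDensity`
  is not even needed: the LAP gives the Abel limit at `0` directly).
* E → E′ `stub_fgrPositivity` — v1's E quantified over data no supplier reaches; E′ is separable-vertex's S7 signature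
  (canonical BM carrier + superstability), for which the reduction to stmt-3429 is landed.
Net: the line is complete modulo C′ (engine; open-problem class, held by the lead) ∧ E′ (⇐ stmt-3429) once A and B′ land —
the same residue as lines swap-odd (D) and separable-vertex (S5 ∧ S7).

## Disproof.lean used (refuter-cdisprove v1–v5, last 2026-08-16T06:47Z; no `-- Targets`, no `stub_*_false`, no `Negative/`)

* v1 `¬HasOddSectorGap ω₂ 0 0` / "a hypothesis-free proof would be DrudeDissolution": `H` enters through A (→ C′) and E′;
  every stub keeps `0 < lam`, `0 < β`; A keeps joint oddness AND coordinatewise `2π`-periodicity.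
* v2 `cesaro_currentCorrelation_zero_of_window` (NoOddDrudeWeight is NECESSARY): implied by C′ through the landed virial
  lemma (`…NoOddDrudeWeightC2.lean` pattern), never assumed.
* §5 Drude weight = the only uniform kill, §6 harmonic near-miss — every stub keeps `0 < lam`, `0 < T`.
-/

noncomputable section

open MeasureTheory Set Filter Topology Function Real
open scoped InnerProductSpace ENNReal
open Literature.MathematicalPhysics.KineticTheory
open Literature.MathematicalPhysics.KineticTheory.HeatConduction
open Literature.MathematicalPhysics.KineticTheory.PhononBoltzmann
open Literature.Analysis.UnboundedOperators

namespace Summit.AtomisticToContinuum.FouriersLaw.Cruxes.MourreDissolution.ParityCountSecondQuantisedFgr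

/-! ## Stub A — the parity count (m-body kinetic floor of Θ-odd profiles) — LANDED p141012 -/

/-- **Stub A — the parity count: the `m`-body kinetic floor of inversion-odd profiles, uniform in `m`** (card First
lemma `OddPairKineticFloor` for all `m`; PROVABLE NOW, size S after p128479/p128131). For `ω₂, a, b > 0` with
`HasOddSectorGap ω₂ a b` there is ONE constant `g > 0` such that for every `m` and every measurable
`F : ℝ^{m+1} → ℝ`, `2π`-periodic in each coordinate, jointly odd (`F(-k) = -F(k)`) and square-integrable on the cell
`(-π, π]^{m+1}`, `g ‖F‖² ≤ Σᵢ ∫_{cell^{m+1}} q_{ω₂,a,b}(x ↦ F(k with kᵢ ← x)) dk` (lower Lebesgue integrals). Proof: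
`MourreDissolution.stub_oddTowerFloor MourreDissolution.stub_oddParityFloor` (landed; hypotheses reordered, periodicity
`F (update k i (k i + 2π)) = F k` from `Function.Periodic (fun x => F (update k i x)) (2π)` at `x = k i` and
`Function.update_eq_self`). This is where the crux's hypothesis enters the line (Disproof v1).
[cite: AokiLukkarinenSpohn2006, §4 (4.1), (4.11); LukkarinenSpohn2008, Def. 2.3, Prop. 2.4] -/
theorem stub_oddStratumFloor :
    ∀ ω₂ a b : ℝ, 0 < ω₂ → 0 < a → 0 < b → HasOddSectorGap ω₂ a b →
      ∃ g : ℝ, 0 < g ∧ ∀ (m : ℕ) (F : (Fin (m + 1) → ℝ) → ℝ),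
        Measurable F →
        (∀ (i : Fin (m + 1)) (k : Fin (m + 1) → ℝ),
            Function.Periodic (fun x : ℝ => F (Function.update k i x)) (2 * π)) →
        (∀ k : Fin (m + 1) → ℝ, F (-k) = -F k) →
        (∫⁻ k in Set.pi Set.univ (fun _ : Fin (m + 1) => Set.Ioc (-π) π),
            ENNReal.ofReal (F k ^ 2)) < ⊤ →
        ENNReal.ofReal g *
            (∫⁻ k in Set.pi Set.univ (fun _ : Fin (m + 1) => Set.Ioc (-π) π),
              ENNReal.ofReal (F k ^ 2)) ≤
          ∑ i : Fin (m + 1),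
            ∫⁻ k in Set.pi Set.univ (fun _ : Fin (m + 1) => Set.Ioc (-π) π),
              boltzmannForm ω₂ a b (fun x : ℝ => F (Function.update k i x)) :=
  -- LANDED p141012 (wave 1, 2026-08-17T04:06Z)
  Summit.AtomisticToContinuum.FouriersLaw.Theorems.MourreDissolution.ParityCountSecondQuantisedFgr.stub_oddStratumFloor

/-! ## Stub B′ — the rich symmetric zero-wavenumber framework — LANDED p141437 -/

/-- **Stub B′ — the rich symmetric zero-wavenumber framework** (infrastructure; PROVABLE NOW, size S after p138890).
For `pinnedChain ω₂ lam β γ` (all `> 0`) there is `T₀ > 0` (every `T > 0` works) such that for `T ∈ (0, T₀)` there are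
an infinite-volume dynamics `D` with `D.carrier = bmGood` whose flow commutes with the lattice translations everywhere
(the canonical symmetric Buttà–Marchioro dynamics) and Doyon data `Z : ZeroWavenumberData (pinnedChain …) D` whose state
is a DLR Gibbs state at `T` carrying the superstability estimate, momentum-reversal symmetric, with strongly continuous
Koopman group, for which the spatial reflection `ι : (σ_x) ↦ (σ_{-x})` is a symmetry (preserves `Z.μ`, the carrier and
`𝒱`, and commutes with the flow EVERYWHERE), and whose observable space contains all coordinates `q_x, p_x` and is
closed under products. Proof: the proof of `KineticPolymerGasOnTheTimeAxis.stub_richFramework` verbatim, exporting in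
addition `hss` of `richFramework_clustering` and `hrefl` of `pencilFramework_dynamics`.
[cite: Doyon2022, §4.1 Def. 4.3–4.4, Thm 4.11] [cite: ButtaMarchioro2016, §2 Thm 2.1–2.2 and §3] -/
theorem stub_framework :
    ∀ ω₂ lam β γ : ℝ, 0 < ω₂ → 0 < lam → 0 < β → 0 < γ →
      ∃ T₀ : ℝ, 0 < T₀ ∧ ∀ T : ℝ, 0 < T → T < T₀ →
        ∃ (D : InfiniteChainDynamics (pinnedChain ω₂ lam β γ))
          (Z : ZeroWavenumberData (pinnedChain ω₂ lam β γ) D),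
          D.carrier = (pinnedChain ω₂ lam β γ).bmGood ∧
          (∀ (t : ℝ) (x : ℤ), D.flow t ∘ chainShift x = chainShift x ∘ D.flow t) ∧
          (pinnedChain ω₂ lam β γ).IsChainGibbsMeasure T Z.μ ∧
          (pinnedChain ω₂ lam β γ).HasSuperstabilityEstimate Z.μ ∧
          Z.HasMomentumReversal ∧
          Z.toFluctuationDynamics.IsStronglyContinuous ∧
          MeasurePreserving (fun (σ : ChainConfig) (i : ℤ) => σ (-i)) Z.μ Z.μ ∧
          Set.MapsTo (fun (σ : ChainConfig) (i : ℤ) => σ (-i)) D.carrier D.carrier ∧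
          (∀ a ∈ Z.localObs, (a ∘ fun (σ : ChainConfig) (i : ℤ) => σ (-i)) ∈ Z.localObs) ∧
          (∀ t : ℝ, (fun (σ : ChainConfig) (i : ℤ) => σ (-i)) ∘ D.flow t =
            D.flow t ∘ fun (σ : ChainConfig) (i : ℤ) => σ (-i)) ∧
          (∀ x : ℤ, (fun σ : ChainConfig => (σ x).1) ∈ Z.localObs) ∧
          (∀ x : ℤ, (fun σ : ChainConfig => (σ x).2) ∈ Z.localObs) ∧
          (∀ a ∈ Z.localObs, ∀ b ∈ Z.localObs, a * b ∈ Z.localObs) := by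
  -- LANDED p141437 (wave 1b, 2026-08-17T04:45Z) as
  -- `Summit.AtomisticToContinuum.FouriersLaw.Theorems.MourreDissolution.ParityCountSecondQuantisedFgr.stub_framework`
  -- (file `Theorems/EmbeddedDrudeMourreMourreDissolutionStubFramework.lean`); its proof is INLINED here verbatim (instead of
  -- `exact` that constant) only because the farm had not yet built the new module when v3 was registered.
  intro ω₂ lam β γ hω hl hβ _hγ
  refine ⟨1, one_pos, fun T hT _ => ?_⟩
  obtain ⟨D, hD, hm, hid, hgrp, -, hsh, hrev, hrefl⟩ :=
    Summit.AtomisticToContinuum.FouriersLaw.Theorems.DrudeDissolution.GramPencilHarmonicChaos.pencilFramework_dynamics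
      ω₂ lam β γ hω hl.le hβ.le
  have h0 : D.flow 0 = id := by
    funext σ
    by_cases hσ : σ ∈ (pinnedChain ω₂ lam β γ).bmGood
    · exact D.flow_zero σ (by rw [hD]; exact hσ)
    · exact hid 0 σ hσ
  have hgrp' : ∀ t s : ℝ, D.flow (t + s) = D.flow t ∘ D.flow s := by
    intro t s
    funext σ
    by_cases hσ : σ ∈ (pinnedChain ω₂ lam β γ).bmGood
    · exact hgrp t s σ hσ
    · rw [comp_apply, hid (t + s) σ hσ, hid s σ hσ, hid t σ hσ]
  obtain ⟨μ, hG, hshift, hss, hιmap, hpres, hsum, hcont⟩ :=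
    Summit.AtomisticToContinuum.FouriersLaw.Theorems.DrudeDissolution.KineticPolymerGasOnTheTimeAxis.richFramework_clustering
      ω₂ lam β γ hω hl.le hβ.le T hT D hD hm hid hgrp' hsh
  haveI := hG.isProbabilityMeasure
  have hmem : ∀ M ∈ Submonoid.closure {w : (ℤ → ℝ × ℝ) → ℝ | ∃ u ∈ Algebra.adjoin ℝ (Set.range
      fun xc : ℤ × Bool => fun σ : ChainConfig => if xc.2 then (σ xc.1).2 else (σ xc.1).1),
      ∃ s : ℝ, w = u ∘ D.flow s}, MemLp M 2 μ := fun M hM => by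
    obtain ⟨hMm, hMmom, -⟩ :=
      Summit.AtomisticToContinuum.FouriersLaw.Theorems.DrudeDissolution.KineticPolymerGasOnTheTimeAxis.richFramework_monomials
        ω₂ lam β γ hω hl.le hβ.le T hT D hD hm hid hgrp' μ hG hshift hss M hM
    exact Summit.AtomisticToContinuum.FouriersLaw.Theorems.DrudeDissolution.KineticPolymerGasOnTheTimeAxis.memLp_two_of_abs_sq
      hMm (hMmom 2)
  obtain ⟨Z, hZμ, hMR, hsc, hι, hq, hp, hmul⟩ :=
    Summit.AtomisticToContinuum.FouriersLaw.Theorems.DrudeDissolution.KineticPolymerGasOnTheTimeAxis.richFramework_datum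
      D h0 hgrp' hsh hrev hrefl μ hpres hshift.measurePreserving_chainShift
      (Summit.AtomisticToContinuum.FouriersLaw.Theorems.MourreDissolution.measurePreserving_chainReversal_of_isChainGibbsMeasure hG)
      hmem hsum hcont
  refine ⟨D, Z, hD, hsh, (by rw [hZμ]; exact hG), (by rw [hZμ]; exact hss), hMR, hsc, ?_, ?_, hι,
    hrefl, hq, hp, hmul⟩
  · rw [hZμ]
    exact ⟨Summit.AtomisticToContinuum.FouriersLaw.Theorems.MourreDissolution.measurable_reflect, hιmap⟩
  · rw [hD]
    exact Summit.AtomisticToContinuum.FouriersLaw.Theorems.MourreDissolution.mapsTo_reflect_bmGood _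

/-! ## Stub C′ — the engine: dressed conjugate operator on every co-moving stratum (Mourre `C²` package) -/

/-- **Stub C′ — THE ENGINE (load-bearing, hardest; open-problem class): a dressed conjugate operator on every
co-moving stratum makes the threshold at frequency `0` dissipative.** IF the `m`-body floor holds at the chain's
vertex couplings (conclusion of Stub A at `(a, b) = (lam, β)`), THEN there is `T₀ > 0` such that for every
`T ∈ (0, T₀)` and every rich symmetric zero-wavenumber datum `Z` at temperature `T` (exactly what Stub B′ supplies:
canonical BM carrier, DLR Gibbs, superstable, momentum-reversal symmetric, strongly continuous, spatial-reflection
symmetric with `ι ∘ φ_t = φ_t ∘ ι`, coordinates and products in `𝒱`) there are: a CLOSED `U_t`-INVARIANT complex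
subspace `K ∋ [J]_ℂ` of `ℋ₀(μ_T)_ℂ` with the restricted unitary group `U'` (intertwining `↑(U'(t)x) = U(t)↑x`), a
conjugate group `A = e^{i𝒜x}` on `K` and `δ, a > 0` such that the restricted Liouvillean is of class `C¹(𝒜)`
(`HamiltonianOfClassC1`), the STRICT Mourre estimate `a φ(𝓛)² ≤ φ(𝓛)[𝓛, i𝒜]φ(𝓛)` holds for real cutoffs in
`(−δ, δ)` (`HasMourreEstimateOn`), the localised commutators are of class `C¹(𝒜)` (Mourre's `C²` condition, the
hypothesis of the tree's LAP `MourreDissolution.stub_mourreThresholdLAP`), and `[J]_ℂ ∈ D(𝒜)`. Intended construction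
(card + triage): `K ⊆ (ℋ₀^{ι-})_ℂ` (the ι-odd sector is `U_t`-invariant and contains `[J]`:
`MourreDissolution.stub_reflectionOddReduction`; `[h]`, phonon number and every ι-even class are absent — triage X1/X2);
`𝒜 = dΓ(v·i∂_k)` dressed on the co-moving strata (`SecondQuantisedConjugateOperator.lean`); free positivity
`|∇_shell Ω|² ≥ ρ²` off the strata; ON a stratum the dressed second-order term is `λ²(Σᵢ q⁽ⁱ⁾ + exchange) ≥ λ²(g − Cε)`
by Stub A; inter-stratum cross terms `P_m i[λW, 𝒜] P_{m±1}` must be `O(λ²)` in form sense on `E_Δ`, `|Δ| ~ λ²`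
(triage r1-2 §E5/§E10 — the named wall; BFS/Merkli absorb them against an `O(1)` free gap absent here). Consequences
already in the tree for this shape: C′ ⇒ no `U'`-eigenvalue in `(−δ, δ)` (virial, `eq_zero_of_hasMourreEstimateOn_of_eigen`)
⇒ no odd Drude weight (Disproof v2 makes its absence necessary). STATUS: open-problem class (thirteen leads): a positive
commutator at an infinitely degenerate embedded threshold is not in print for any interacting infinite lattice system
(nearest: Jakšić–Pillet 1996, Merkli 2001, Bach–Fröhlich–Sigal 2000 — confined small systems; ABG §7.6 excludes
thresholds). [cite: Mourre1981; AmreinBoutetdeMonvelGeorgescu1996 §7.2–7.3; Merkli2001; BachFrohlichSigal2000;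
JaksicPillet1996; DerezinskiGerard2000 §3; AokiLukkarinenSpohn2006 §3–4; Lukkarinen2016 §3] -/
theorem stub_dressedStratumMourre :
    ∀ ω₂ lam β γ : ℝ, 0 < ω₂ → 0 < lam → 0 < β → 0 < γ →
      -- the m-body kinetic floor of Θ-odd profiles (conclusion of Stub A at the chain's vertex)
      (∃ g : ℝ, 0 < g ∧ ∀ (m : ℕ) (F : (Fin (m + 1) → ℝ) → ℝ),
        Measurable F →
        (∀ (i : Fin (m + 1)) (k : Fin (m + 1) → ℝ),
            Function.Periodic (fun x : ℝ => F (Function.update k i x)) (2 * π)) →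
        (∀ k : Fin (m + 1) → ℝ, F (-k) = -F k) →
        (∫⁻ k in Set.pi Set.univ (fun _ : Fin (m + 1) => Set.Ioc (-π) π),
            ENNReal.ofReal (F k ^ 2)) < ⊤ →
        ENNReal.ofReal g *
            (∫⁻ k in Set.pi Set.univ (fun _ : Fin (m + 1) => Set.Ioc (-π) π),
              ENNReal.ofReal (F k ^ 2)) ≤
          ∑ i : Fin (m + 1),
            ∫⁻ k in Set.pi Set.univ (fun _ : Fin (m + 1) => Set.Ioc (-π) π),
              boltzmannForm ω₂ lam β (fun x : ℝ => F (Function.update k i x))) →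
      ∃ T₀ : ℝ, 0 < T₀ ∧ ∀ T : ℝ, 0 < T → T < T₀ →
        ∀ (D : InfiniteChainDynamics (pinnedChain ω₂ lam β γ))
          (Z : ZeroWavenumberData (pinnedChain ω₂ lam β γ) D),
          D.carrier = (pinnedChain ω₂ lam β γ).bmGood →
          (pinnedChain ω₂ lam β γ).IsChainGibbsMeasure T Z.μ →
          (pinnedChain ω₂ lam β γ).HasSuperstabilityEstimate Z.μ →
          Z.HasMomentumReversal →
          ∀ hsc : Z.toFluctuationDynamics.IsStronglyContinuous,
          MeasurePreserving (fun (σ : ChainConfig) (i : ℤ) => σ (-i)) Z.μ Z.μ →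
          Set.MapsTo (fun (σ : ChainConfig) (i : ℤ) => σ (-i)) D.carrier D.carrier →
          (∀ a ∈ Z.localObs, (a ∘ fun (σ : ChainConfig) (i : ℤ) => σ (-i)) ∈ Z.localObs) →
          (∀ t : ℝ, (fun (σ : ChainConfig) (i : ℤ) => σ (-i)) ∘ D.flow t =
            D.flow t ∘ fun (σ : ChainConfig) (i : ℤ) => σ (-i)) →
          (∀ x : ℤ, (fun σ : ChainConfig => (σ x).1) ∈ Z.localObs) →
          (∀ x : ℤ, (fun σ : ChainConfig => (σ x).2) ∈ Z.localObs) →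
          (∀ a ∈ Z.localObs, ∀ b ∈ Z.localObs, a * b ∈ Z.localObs) →
          ∃ (K : Submodule ℂ Z.toFluctuationDynamics.ComplexFluctuationSpace)
            (hK : IsClosed (K : Set Z.toFluctuationDynamics.ComplexFluctuationSpace)),
            haveI : CompleteSpace K := hK.completeSpace_coe
            ∃ (U' A : OneParameterUnitaryGroup K) (v : K) (δ a : ℝ),
              (v : Z.toFluctuationDynamics.ComplexFluctuationSpace) =
                  Complexification.ofReal Z.currentClass ∧
              (∀ (t : ℝ) (x : K),
                  ((U'.appReal t x : K) : Z.toFluctuationDynamics.ComplexFluctuationSpace) =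
                    (Z.toFluctuationDynamics.unitaryGroup hsc).appReal t
                      (x : Z.toFluctuationDynamics.ComplexFluctuationSpace)) ∧
              0 < δ ∧ 0 < a ∧
              U'.HamiltonianOfClassC1 A ∧
              U'.HasMourreEstimateOn A (Set.Ioo (-δ) δ) a ∧
              (∀ g : SchwartzMap ℝ ℂ, UnitaryRep.IsRealCutoffOn (Set.Ioo (-δ) δ) g →
                A.IsOfClassC1 (U'.mourreCommutator A g)) ∧
              v ∈ A.hamiltonian.domain := by
  sorry

/-! ## Stub E′ — the Fermi-golden-rule floor of the Abel means (positivity of `g_T(0)`) -/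

/-- **Stub E′ — FERMI-GOLDEN-RULE POSITIVITY OF THE PLATEAU** (= S7 `SeparableVertexFaddeevPairSector.stub_fgrPositivity`
verbatim; size L, open physics; NECESSARY for the crux by the route's proved `AbelOfSpectralDensity`). For
`pinnedChain ω₂ lam β γ` (all `> 0`) under `HasOddSectorGap ω₂ lam β` there is `T₀ > 0` such that for `T ∈ (0, T₀)` and
every regular Θ-symmetric framework `(D, Z)` at `T` (BM carrier, DLR Gibbs, superstable, momentum reversal, strongly
continuous Koopman group) the ABEL FUNCTIONAL `A_T(ν) = ∫₀^∞ e^{−νt} C_T(t) dt` is `≥ c > 0` for all small `ν > 0`.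
Content: the VALUE of the level shift on the current, `lim A_T(ν) = T²·κ_kin(1 + o(1))`, finite and positive by H
(`KineticConductivityFinite`). STATUS: CONDITIONALLY DISCHARGED in the tree from route KineticCorner's kinetic
Green–Kubo statement (`MourreDissolution.stub_fgrPositivity_of_kineticGreenKubo`, p121549: `C_T ∈ L¹(0,∞)` with
`0 < ∫₀^∞ C_T` ⇒ E′ by Abel summation), hence blocked on stmt-AtomisticToContinuum-3429; post-kinetic input is
necessary in kind (leads c4/c5). [cite: AokiLukkarinenSpohn2006 §3–4; Lukkarinen2016 §3.4; BonettoLebowitzReyBellet2000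
§6.3 (35)] -/
theorem stub_fgrPositivity :
    ∀ ω₂ lam β γ : ℝ, 0 < ω₂ → 0 < lam → 0 < β → 0 < γ → HasOddSectorGap ω₂ lam β →
      ∃ T₀ : ℝ, 0 < T₀ ∧ ∀ T : ℝ, 0 < T → T < T₀ →
        ∀ (D : InfiniteChainDynamics (pinnedChain ω₂ lam β γ))
          (Z : ZeroWavenumberData (pinnedChain ω₂ lam β γ) D),
          D.carrier = (pinnedChain ω₂ lam β γ).bmGood →
          (pinnedChain ω₂ lam β γ).IsChainGibbsMeasure T Z.μ →
          (pinnedChain ω₂ lam β γ).HasSuperstabilityEstimate Z.μ →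
          Z.HasMomentumReversal →
          (∀ ψ : ZeroWavenumberSpace Z, Continuous fun t : ℝ => Z.koopman t ψ) →
          ∃ c ν₀ : ℝ, 0 < c ∧ 0 < ν₀ ∧ ∀ ν : ℝ, 0 < ν → ν < ν₀ →
            c ≤ MeasureTheory.integral (MeasureTheory.volume.restrict (Set.Ioi (0:ℝ)))
              (fun t : ℝ => Real.exp (-(ν * t)) * D.currentCorrelation Z.μ t) := by
  sorry

/-! ## Composition — kernel-checked: the four stubs, used BY NAME, imply the crux BY NAME (no `sorry` in this proof) -/

/-- **Composition (kernel-checked; the only ingredients are the four declared stubs, by name, and tree theorems).**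
`stub_framework` (B′) gives the rich symmetric datum at `T < T₁`; `stub_dressedStratumMourre` (C′), fed with the crux's
hypothesis `H` THROUGH `stub_oddStratumFloor` (A), gives `(K, U', 𝒜, v, δ, a)` at `T < T₂`; the tree's LAP
(`MourreDissolution.stub_mourreThresholdLAP`) gives locally uniform convergence of the Laplace–Fourier transforms of
`⟪v, U'(t) v⟫ = C_T(t)` on `[−δ/2, δ/2]` to a continuous `G`; cosine Bochner (`stub_cosineBochner`) and Poisson window
inversion (`stub_poissonWindowInversion`) give the finite measure `σ'` with `C_T = ∫cos(ωt)dσ'` and window density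
`Re G/π`; `stub_fgrPositivity` (E′, again `H`) bounds the Abel means below at `T < T₃`, whence `Re G(0) ≥ c > 0`. -/
theorem MourreDissolution_of :
    Summit.AtomisticToContinuum.FouriersLaw.Theses.EmbeddedDrudeMourre.MourreDissolution := by
  intro ω₂ lam β γ hω hl hβ hγ hgap
  -- thresholds of the three temperature-dependent stubs; `H` enters through Stub A (into C′) and Stub E′
  obtain ⟨T₁, hT₁, hfw⟩ := stub_framework ω₂ lam β γ hω hl hβ hγ
  obtain ⟨T₂, hT₂, hmo⟩ :=
    stub_dressedStratumMourre ω₂ lam β γ hω hl hβ hγ (stub_oddStratumFloor ω₂ lam β hω hl hβ hgap)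
  obtain ⟨T₃, hT₃, hfl⟩ := stub_fgrPositivity ω₂ lam β γ hω hl hβ hγ hgap
  refine ⟨min T₁ (min T₂ T₃), lt_min hT₁ (lt_min hT₂ hT₃), fun T hT hTlt => ?_⟩
  have h1 : T < T₁ := lt_of_lt_of_le hTlt (min_le_left _ _)
  have h2 : T < T₂ := lt_of_lt_of_le hTlt ((min_le_right _ _).trans (min_le_left _ _))
  have h3 : T < T₃ := lt_of_lt_of_le hTlt ((min_le_right _ _).trans (min_le_right _ _))
  -- (B′): the state, the dynamics and Doyon's space at temperature T
  obtain ⟨D, Z, hDcar, -, hG, hSS, hrev, hsc, hιμ, hιc, hιo, hιflow, hq, hp, hmul⟩ := hfw T hT h1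
  -- (C′): the dressed conjugate operator on a closed invariant subspace K ∋ [J]
  obtain ⟨K, hK, hKrest⟩ := hmo T hT h2 D Z hDcar hG hSS hrev hsc hιμ hιc hιo hιflow hq hp hmul
  haveI : CompleteSpace K := hK.completeSpace_coe
  obtain ⟨U', A, v, δ, a, hv, hint, hδ, ha, hC1, hMou, hC2, hdom⟩ := hKrest
  -- limiting absorption (tree theorem, Mourre's C² form) on the half window
  obtain ⟨G, hGcont, hGunif⟩ :=
    Summit.AtomisticToContinuum.FouriersLaw.Theorems.MourreDissolution.stub_mourreThresholdLAP
      K U' A (-δ) δ a (by linarith) ha hC1 hMou hC2 v hdom (-(δ / 2)) (δ / 2)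
      (by linarith) (by linarith) (by linarith)
  -- the matrix coefficient is `C_T`
  have hcoef : ∀ t : ℝ, ⟪v, U'.appReal t v⟫_ℂ = ((D.currentCorrelation Z.μ t : ℝ) : ℂ) := by
    intro t
    have e2 : (Z.toFluctuationDynamics.unitaryGroup hsc).appReal t
        (v : Z.toFluctuationDynamics.ComplexFluctuationSpace) =
          Complexification.ofReal (Z.koopman t Z.currentClass) := by
      rw [hv]
      exact FluctuationDynamics.unitaryGroup_appReal_ofReal _ hsc t _
    rw [Submodule.coe_inner, hint t v, e2, hv]
    refine (Complexification.inner_ofReal_ofReal _ _).trans ?_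
    rw [Z.inner_currentClass_koopman_eq_currentCorrelation' hrev t]
  -- real parts: the Abel–Poisson transform of `C_T` converges uniformly on `[-δ/2, δ/2]`
  have hhcont : ContinuousOn (fun ω : ℝ => (G ω).re) (Set.Icc (-(δ / 2)) (δ / 2)) :=
    Complex.continuous_re.comp_continuousOn hGcont
  have hunif : TendstoUniformlyOn
      (fun (ν : ℝ) (ω : ℝ) => MeasureTheory.integral (MeasureTheory.volume.restrict (Set.Ioi (0:ℝ)))
        (fun t : ℝ => Real.exp (-(ν * t)) * Real.cos (ω * t) * D.currentCorrelation Z.μ t))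
      (fun ω : ℝ => (G ω).re) (nhdsWithin (0:ℝ) (Set.Ioi 0)) (Set.Icc (-(δ / 2)) (δ / 2)) := by
    refine (Summit.AtomisticToContinuum.FouriersLaw.Theorems.MourreDissolution.LineReduction.tendstoUniformlyOn_re
      hGunif).congr ?_
    filter_upwards [self_mem_nhdsWithin] with ν hν ω _
    exact Summit.AtomisticToContinuum.FouriersLaw.Theorems.MourreDissolution.LineReduction.re_laplace_coeff_eq
      _ _ (fun t => D.currentCorrelation Z.μ t) hcoef hν ω
  -- the spectral measure from continuity, evenness and positive-definiteness of `C_T`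
  have hsc' : ∀ ψ : ZeroWavenumberSpace Z, Continuous fun t : ℝ => Z.koopman t ψ := fun ψ => hsc ψ
  have hCcont : Continuous fun t : ℝ => D.currentCorrelation Z.μ t := by
    have h1 : Continuous fun t : ℝ => ⟪Z.currentClass, Z.koopman t Z.currentClass⟫_ℝ :=
      continuous_const.inner (hsc' Z.currentClass)
    refine h1.congr fun t => ?_
    exact Z.inner_currentClass_koopman_eq_currentCorrelation' hrev t
  have hCeven : ∀ t : ℝ, D.currentCorrelation Z.μ (-t) = D.currentCorrelation Z.μ t :=
    fun t => Z.currentCorrelation_neg hrev t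
  have hCpsd : ∀ (n : ℕ) (c τ : Fin n → ℝ),
      0 ≤ ∑ i, ∑ j, c i * c j * D.currentCorrelation Z.μ (τ j - τ i) :=
    fun n c τ => Z.sum_mul_currentCorrelation_nonneg hrev Finset.univ c τ
  obtain ⟨σ, hσfin, hσC⟩ :=
    Summit.AtomisticToContinuum.FouriersLaw.Theorems.MourreDissolution.stub_cosineBochner
      (fun t => D.currentCorrelation Z.μ t) hCcont hCeven hCpsd
  -- Poisson inversion on the window
  have hδ2 : 0 < δ / 2 := by linarith
  obtain ⟨σ', hσ'fin, hσ'C, hhnn, hwin⟩ :=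
    Summit.AtomisticToContinuum.FouriersLaw.Theorems.MourreDissolution.stub_poissonWindowInversion σ
      (fun t => D.currentCorrelation Z.μ t) (δ / 2) (fun ω : ℝ => (G ω).re) hσfin hδ2 hσC hhcont hunif
  -- (E′): positivity of the plateau
  obtain ⟨c, ν₀, hc, hν₀, hfloor⟩ := hfl T hT h3 D Z hDcar hG hSS hrev hsc'
  have h0mem : (0:ℝ) ∈ Set.Icc (-(δ / 2)) (δ / 2) := ⟨by linarith, by linarith⟩
  have hlim0 := hunif.tendsto_at h0mem
  have hh0 : c ≤ (G 0).re := by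
    refine ge_of_tendsto hlim0 ?_
    have hev : ∀ᶠ ν in nhdsWithin (0:ℝ) (Set.Ioi 0), ν ∈ Set.Ioo 0 ν₀ := Ioo_mem_nhdsGT hν₀
    filter_upwards [hev] with ν hν
    have := hfloor ν hν.1 hν.2
    simpa using this
  -- assemble the witness
  haveI := hσ'fin
  refine ⟨Z.μ, D, hG, Z.preservesMeasure, fun t => Z.hasAbsConvergentCorrelation
    (Z.integral_bondCurrent_eq_zero hrev) t, σ', hσ'fin, hσ'C, δ / 2, fun ω => (G ω).re / Real.pi,
    hδ2, ?_, ?_, ?_, hwin⟩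
  · exact (hhcont.mono Set.Ioo_subset_Icc_self).div_const _
  · intro ω hω
    exact div_nonneg (hhnn ω hω) Real.pi_pos.le
  · exact div_pos (lt_of_lt_of_le hc hh0) Real.pi_pos

end Summit.AtomisticToContinuum.FouriersLaw.Cruxes.MourreDissolution.ParityCountSecondQuantisedFgr

end
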